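import Summits.Ventures.PercRepro.RankLevelSetDepCountGiantA

/-!
# PercRepro — THE PAIR MACHINERY OF THE `U`-COUNT, PER SIZE — PART A2: THE LEVEL-`m` DOUBLE COUNT, THE FIBRE AND PAIR
BOUNDS (p8, S3)

Continues `RankLevelSetDepCountGiantA` (part A1: the definitions, the pair data, the per-set multiplicity
`card_pairs_ge`): `mul_card_levelF_le_sum` (the level-`m` double count), `card_fibreLevel_le_choose` (the fibre at one
level), night-1's pair bounds `card_pairsF_le` / `card_pairsBig_le` re-proved for the definitions, the small / big fibre
bounds, and `ncard_dep_le_sum_levelF` (the dependent sets are covered by the levels `q + 1 ≤ m ≤ d`).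
Axioms: standard.
-/

open scoped Matroid

namespace PercRepro

namespace Matroid

open Set Finset

variable {α : Type} {M : _root_.Matroid α}

open scoped Classical in
/-- Membership in `levelF`. -/
theorem mem_levelF [M.Finite] {q m : ℕ} {B : Finset α} :
    B ∈ levelF M q m ↔ B ⊆ groundF M ∧ B.card = m ∧ M.eRk (B : Set α) = (q : ℕ∞) := by
  unfold levelF
  rw [Finset.mem_filter, Finset.mem_powersetCard]
  tauto

open scoped Classical in
/-- **The level-`m` double count**: `(m − q)·#levelF M q m ≤ Σ_{p ∈ pairsF M q} #fibreLevel M q p m`. -/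
theorem mul_card_levelF_le_sum [M.Finite] (q : ℕ) (hcirc : ∀ C, M.IsCircuit C → 3 ≤ C.encard) (m : ℕ) :
    (m - q) * (levelF M q m).card ≤ ∑ p ∈ pairsF M q, (fibreLevel M q p m).card := by
  have hcomm : ∑ p ∈ pairsF M q, (fibreLevel M q p m).card =
      ∑ B ∈ levelF M q m, ((pairsF M q).filter (fun p => p.1 ∪ p.2 ⊆ (B : Set α) ∧
        (B : Set α) ⊆ M.closure (p.1 ∪ p.2))).card := by
    unfold fibreLevel
    simp only [Finset.card_filter]
    exact Finset.sum_comm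
  rw [hcomm]
  calc (m - q) * (levelF M q m).card = ∑ _B ∈ levelF M q m, (m - q) := by simp [mul_comm]
    _ ≤ _ := by
      apply Finset.sum_le_sum
      intro B hB
      obtain ⟨hBg, hBm, hBq⟩ := mem_levelF.1 hB
      have hBE : (B : Set α) ⊆ M.E := by rw [← coe_groundF]; exact_mod_cast hBg
      have := card_pairs_ge q hcirc hBE hBq
      rw [hBm] at this
      exact this

open scoped Classical in
/-- **The fibre at one level**: `#fibreLevel M q p m ≤ C(|cl(C ∪ B′) ∖ (C ∪ B′)|, m − (q + 1))` — `B ↦ B ∖ (C ∪ B′)`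
is injective into the `(m − q − 1)`-subsets of the free points of the closure. -/
theorem card_fibreLevel_le_choose [M.Finite] (q : ℕ) {p : Set α × Set α} (hp : p ∈ pairsF M q) (m : ℕ) :
    (fibreLevel M q p m).card ≤ (M.closure (p.1 ∪ p.2) \ (p.1 ∪ p.2)).ncard.choose (m - (q + 1)) := by
  obtain ⟨hp1E, hp2E, hU, -, -⟩ := pairsF_data hp
  set U := p.1 ∪ p.2 with hUdef
  have hUE : U ⊆ M.E := union_subset hp1E hp2E
  have hUfin : U.Finite := M.ground_finite.subset hUE
  have hFfin : (M.closure U).Finite := M.ground_finite.subset (M.closure_subset_ground _)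
  have hDfin : (M.closure U \ U).Finite := hFfin.subset Set.sdiff_subset
  have hUF : U ⊆ M.closure U := M.subset_closure U hUE
  rw [Set.ncard_eq_toFinset_card _ hDfin, ← Finset.card_powersetCard (m - (q + 1)) hDfin.toFinset]
  apply Finset.card_le_card_of_injOn (fun B => B \ hUfin.toFinset)
  · intro B hB
    rw [Finset.mem_coe] at hB
    unfold fibreLevel at hB
    rw [Finset.mem_filter] at hB
    obtain ⟨hBl, hUB, hBcl⟩ := hB
    obtain ⟨-, hBm, -⟩ := mem_levelF.1 hBl
    rw [Finset.mem_coe, Finset.mem_powersetCard]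
    constructor
    · intro x hx
      rw [Finset.mem_sdiff, Set.Finite.mem_toFinset] at hx
      rw [Set.Finite.mem_toFinset]
      exact ⟨hBcl (by exact_mod_cast hx.1), hx.2⟩
    · have hUB' : hUfin.toFinset ⊆ B := by
        intro x hx
        rw [Set.Finite.mem_toFinset] at hx
        exact_mod_cast hUB hx
      rw [Finset.card_sdiff, Finset.inter_eq_left.2 hUB', hBm, ← Set.ncard_eq_toFinset_card _ hUfin, hU]
  · intro B hB B' hB' hBB'
    rw [Finset.mem_coe] at hB hB'
    unfold fibreLevel at hB hB'
    rw [Finset.mem_filter] at hB hB'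
    have hUB : hUfin.toFinset ⊆ B := by
      intro x hx
      rw [Set.Finite.mem_toFinset] at hx
      exact_mod_cast hB.2.1 hx
    have hUB' : hUfin.toFinset ⊆ B' := by
      intro x hx
      rw [Set.Finite.mem_toFinset] at hx
      exact_mod_cast hB'.2.1 hx
    have h1 : B = (B \ hUfin.toFinset) ∪ hUfin.toFinset := (Finset.sdiff_union_of_subset hUB).symm
    have h2 : B' = (B' \ hUfin.toFinset) ∪ hUfin.toFinset := (Finset.sdiff_union_of_subset hUB').symm
    rw [h1, h2]
    have hBB'' : B \ hUfin.toFinset = B' \ hUfin.toFinset := hBB'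
    rw [hBB'']

open scoped Classical in
/-- The pairs with a small closure (`≤ f′ + 1` points). -/
noncomputable def pairsSmall (M : _root_.Matroid α) [M.Finite] (q f' : ℕ) : Finset (Set α × Set α) :=
  (pairsF M q).filter (fun p => (M.closure (p.1 ∪ p.2)).ncard ≤ f' + 1)

open scoped Classical in
/-- The pairs with a big closure (`> f′ + 1` points). -/
noncomputable def pairsBig (M : _root_.Matroid α) [M.Finite] (q f' : ℕ) : Finset (Set α × Set α) :=
  (pairsF M q).filter (fun p => ¬ (M.closure (p.1 ∪ p.2)).ncard ≤ f' + 1)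

open scoped Classical in
/-- The number of pairs (night-1's bound): `#pairsF ≤ Σ_k s_k·C(n, q + 1 − k)`. -/
theorem card_pairsF_le [M.Finite] (q : ℕ) :
    (pairsF M q).card ≤
      ∑ k ∈ Finset.Icc 3 (q + 1), {C | M.IsCircuit C ∧ C.ncard = k}.ncard * M.E.ncard.choose (q + 1 - k) := by
  unfold pairsF
  refine (Finset.card_filter_le _ _).trans ?_
  refine Finset.card_biUnion_le.trans ?_
  apply Finset.sum_le_sum
  intro k _
  rw [Finset.card_product, card_circF]
  exact Nat.mul_le_mul_left _ ((card_subsF_le _ _).trans (by rw [card_groundF]))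

open scoped Classical in
/-- The big pairs live inside `S₀ = ⋃ {circuits with ≤ q + 1 elements}` (night-1's
`big_flat_subset_sUnion_circuitsLE`), whence `#pairsBig ≤ Σ_k s_k·C((q+1)d, q + 1 − k)`. -/
theorem card_pairsBig_le [M.Finite] (q f' : ℕ) (hq : 1 ≤ q)
    (hflat' : ∀ X ⊆ M.E, M.eRk X ≤ (q - 1 : ℕ) → X.ncard ≤ f') {d : ℕ} (hd : M.E.encard = M.eRank + d) :
    (pairsBig M q f').card ≤
      ∑ k ∈ Finset.Icc 3 (q + 1), {C | M.IsCircuit C ∧ C.ncard = k}.ncard * ((q + 1) * d).choose (q + 1 - k) := by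
  set S₀ := ⋃₀ circuitsLE M (q + 1) with hS₀
  have hS₀E : S₀ ⊆ M.E := by
    intro x hx
    obtain ⟨C, hC, hxC⟩ := mem_sUnion.1 hx
    exact subset_ground_of_mem_circuitsLE hC hxC
  have hS₀fin : S₀.Finite := M.ground_finite.subset hS₀E
  set Sf := hS₀fin.toFinset with hSf
  have hScard : Sf.card ≤ (q + 1) * d := by
    have h := encard_sUnion_circuitsLE_le (M := M) (k := q + 1) (d := d) hd
    rw [← hS₀fin.cast_ncard_eq, Set.ncard_eq_toFinset_card _ hS₀fin] at h
    exact_mod_cast h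
  have hsub : pairsBig M q f' ⊆ (Finset.Icc 3 (q + 1)).biUnion (fun k => circF M k ×ˢ subsF Sf (q + 1 - k)) := by
    intro p hp
    unfold pairsBig at hp
    rw [Finset.mem_filter] at hp
    obtain ⟨hpP, hbig⟩ := hp
    push Not at hbig
    obtain ⟨hp1E, hp2E, hU, hrk, k, hk, h1, hp2c⟩ := pairsF_data hpP
    have hUE : p.1 ∪ p.2 ⊆ M.E := union_subset hp1E hp2E
    have hsub : M.closure (p.1 ∪ p.2) ⊆ S₀ :=
      big_flat_subset_sUnion_circuitsLE hq hflat' hrk hbig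
    have hUF : p.1 ∪ p.2 ⊆ M.closure (p.1 ∪ p.2) := M.subset_closure _ hUE
    rw [Finset.mem_biUnion]
    refine ⟨k, hk, ?_⟩
    rw [Finset.mem_product]
    refine ⟨h1, mem_subsF_of ?_ hp2c⟩
    rw [hSf, Set.Finite.coe_toFinset]
    exact (subset_union_right.trans hUF).trans hsub
  calc (pairsBig M q f').card ≤ ((Finset.Icc 3 (q + 1)).biUnion (fun k => circF M k ×ˢ subsF Sf (q + 1 - k))).card :=
        Finset.card_le_card hsub
    _ ≤ ∑ k ∈ Finset.Icc 3 (q + 1), (circF M k ×ˢ subsF Sf (q + 1 - k)).card := Finset.card_biUnion_le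
    _ ≤ _ := by
        apply Finset.sum_le_sum
        intro k _
        rw [Finset.card_product, card_circF]
        exact Nat.mul_le_mul_left _ ((card_subsF_le _ _).trans (Nat.choose_le_choose _ hScard))

open scoped Classical in
/-- The fibre bound at one level for a SMALL pair: `≤ C(f′ − q, m − q − 1)`. -/
theorem card_fibreLevel_small [M.Finite] (q f' : ℕ) {p : Set α × Set α} (hp : p ∈ pairsSmall M q f') (m : ℕ) :
    (fibreLevel M q p m).card ≤ (f' - q).choose (m - (q + 1)) := by
  unfold pairsSmall at hp
  rw [Finset.mem_filter] at hp
  obtain ⟨hpP, hsmall⟩ := hp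
  obtain ⟨hp1E, hp2E, hU, -, -⟩ := pairsF_data hpP
  have hUE : p.1 ∪ p.2 ⊆ M.E := union_subset hp1E hp2E
  have hFfin : (M.closure (p.1 ∪ p.2)).Finite := M.ground_finite.subset (M.closure_subset_ground _)
  have hUF : p.1 ∪ p.2 ⊆ M.closure (p.1 ∪ p.2) := M.subset_closure _ hUE
  have hFU : (M.closure (p.1 ∪ p.2) \ (p.1 ∪ p.2)).ncard ≤ f' - q := by
    rw [ncard_sdiff hUF (hFfin.subset hUF), hU]
    omega
  exact (card_fibreLevel_le_choose q hpP m).trans (Nat.choose_le_choose _ hFU)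

open scoped Classical in
/-- The fibre bound at one level for a BIG pair: `≤ C(f − (q + 1), m − q − 1)` (every rank-`≤ q` set has `≤ f`
points). -/
theorem card_fibreLevel_big [M.Finite] (q f f' : ℕ) (hflat : ∀ X ⊆ M.E, M.eRk X ≤ q → X.ncard ≤ f)
    {p : Set α × Set α} (hp : p ∈ pairsBig M q f') (m : ℕ) :
    (fibreLevel M q p m).card ≤ (f - (q + 1)).choose (m - (q + 1)) := by
  unfold pairsBig at hp
  rw [Finset.mem_filter] at hp
  obtain ⟨hpP, -⟩ := hp
  obtain ⟨hp1E, hp2E, hU, hrk, -⟩ := pairsF_data hpP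
  have hUE : p.1 ∪ p.2 ⊆ M.E := union_subset hp1E hp2E
  have hFfin : (M.closure (p.1 ∪ p.2)).Finite := M.ground_finite.subset (M.closure_subset_ground _)
  have hFf : (M.closure (p.1 ∪ p.2)).ncard ≤ f :=
    hflat _ (M.closure_subset_ground _) (by rw [M.eRk_closure_eq]; exact hrk)
  have hUF : p.1 ∪ p.2 ⊆ M.closure (p.1 ∪ p.2) := M.subset_closure _ hUE
  have hFU : (M.closure (p.1 ∪ p.2) \ (p.1 ∪ p.2)).ncard ≤ f - (q + 1) := by
    rw [ncard_sdiff hUF (hFfin.subset hUF), hU]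
    omega
  exact (card_fibreLevel_le_choose q hpP m).trans (Nat.choose_le_choose _ hFU)

open scoped Classical in
/-- **The level-`m` count**: `(m − q)·#levelF M q m ≤ #pairsSmall·C(f′ − q, m − q − 1) + #pairsBig·C(f − q − 1, m − q − 1)`. -/
theorem mul_card_levelF_le [M.Finite] (q f f' : ℕ) (hcirc : ∀ C, M.IsCircuit C → 3 ≤ C.encard)
    (hflat : ∀ X ⊆ M.E, M.eRk X ≤ q → X.ncard ≤ f) (m : ℕ) :
    (m - q) * (levelF M q m).card ≤
      (pairsSmall M q f').card * (f' - q).choose (m - (q + 1)) +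
        (pairsBig M q f').card * (f - (q + 1)).choose (m - (q + 1)) := by
  have hsplit : ∑ p ∈ pairsF M q, (fibreLevel M q p m).card =
      ∑ p ∈ pairsSmall M q f', (fibreLevel M q p m).card + ∑ p ∈ pairsBig M q f', (fibreLevel M q p m).card := by
    unfold pairsSmall pairsBig
    exact (Finset.sum_filter_add_sum_filter_not (pairsF M q) _ _).symm
  calc (m - q) * (levelF M q m).card ≤ ∑ p ∈ pairsF M q, (fibreLevel M q p m).card :=
        mul_card_levelF_le_sum q hcirc m
    _ = _ := hsplit
    _ ≤ ∑ _p ∈ pairsSmall M q f', (f' - q).choose (m - (q + 1)) +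
          ∑ _p ∈ pairsBig M q f', (f - (q + 1)).choose (m - (q + 1)) :=
        add_le_add (Finset.sum_le_sum (fun p hp => card_fibreLevel_small q f' hp m))
          (Finset.sum_le_sum (fun p hp => card_fibreLevel_big q f f' hflat hp m))
    _ = _ := by rw [Finset.sum_const, smul_eq_mul, Finset.sum_const, smul_eq_mul]

open scoped Classical in
/-- The dependent rank-`q` sets of at most `d` elements are covered by the levels `q + 1 ≤ m ≤ d`. -/
theorem ncard_dep_le_sum_levelF [M.Finite] (q d : ℕ) :
    {B : Set α | B ⊆ M.E ∧ M.eRk B = q ∧ q < B.ncard ∧ B.ncard ≤ d}.ncard ≤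
      ∑ m ∈ Finset.Icc (q + 1) d, (levelF M q m).card := by
  set T := (Finset.Icc (q + 1) d).biUnion (fun m => levelF M q m) with hT
  have hsub : {B : Set α | B ⊆ M.E ∧ M.eRk B = q ∧ q < B.ncard ∧ B.ncard ≤ d} ⊆
      (T.image (fun s : Finset α => (s : Set α)) : Set (Set α)) := by
    intro B hB
    have hBfin : B.Finite := M.ground_finite.subset hB.1
    rw [Finset.mem_coe, Finset.mem_image]
    refine ⟨hBfin.toFinset, ?_, by simp⟩
    rw [hT, Finset.mem_biUnion]
    have hlt := hB.2.2.1
    have hle := hB.2.2.2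
    refine ⟨B.ncard, by rw [Finset.mem_Icc]; omega, ?_⟩
    rw [mem_levelF]
    refine ⟨?_, (Set.ncard_eq_toFinset_card _ hBfin).symm, by simpa using hB.2.1⟩
    intro x hx
    rw [Set.Finite.mem_toFinset] at hx
    unfold groundF
    rw [Set.Finite.mem_toFinset]
    exact hB.1 hx
  calc _ ≤ (T.image (fun s : Finset α => (s : Set α)) : Set (Set α)).ncard :=
        ncard_le_ncard hsub (Finset.finite_toSet _)
    _ = (T.image (fun s : Finset α => (s : Set α))).card := Set.ncard_coe_finset _
    _ ≤ T.card := Finset.card_image_le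
    _ ≤ _ := Finset.card_biUnion_le

end Matroid

end PercRepro
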